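import Mathlib
import HarnessLib
import Summits.RiemannHypothesis.RiemannHypothesis.Theorems.IntegerScrewWalkLevelsAlgebra
import Summits.RiemannHypothesis.RiemannHypothesis.Theorems.IntegerScrewParityGram

/-!
# Route `IntegerScrew` — the test space of `IntegerScrewWalkRungs.walk_rungs` is `(|𝒮| + 1)`-dimensional:
# `{1} ∪ {φ_S : S ∈ 𝒮}` is linearly independent on `{1, …, M}` once `log M ≥ m·|𝒮|·(B² + B + 1)`

By diagonal dominance of the Gram matrix: `‖φ_S‖² ≥ H_M/m`, `|⟨φ_S, φ_{S'}⟩| ≤ B` (`S ≠ S'`), `|π(φ_S)| ≤ B`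
(`IntegerScrewParityGram`), and the quantitative Gershgorin bound `IntegerScrewWalkLevelsAlgebra.form_ge_diag_sub_offdiag`:
`‖Σ_S a_Sφ_S + c‖² ≥ (H_M/m − |𝒮|B − |𝒮|B²/H_M)·Σ_S a_S² ≥ |𝒮|·Σ_S a_S²`.  This is the dimension count that
turns `walk_rungs` into «at least `|𝒮|` eigenvalues `≤ Λ + η`» by min–max (PIVOT-LAW 13.10 (iv); CONTINUUM-LIMIT
23.18).  RH-free.  Reference for the walk: M. Suzuki, J. Lond. Math. Soc. (2) 108 (2023) 1448–1487 [Suzuki2023].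
-/

noncomputable section

set_option linter.dupNamespace false -- D-0017: `Summit.<S>.<S>.…` is the designed namespace

namespace Summit.RiemannHypothesis.RiemannHypothesis.Theorems.IntegerScrew

open Finset ArithmeticFunction

/-- **Linear independence of `{1} ∪ {φ_S : S ∈ 𝒮}`** (non-empty finite sets of primes, `Π_S p² ≤ m`,
`2^{|S∪S'|} ≤ B` on `𝒮`, `log M ≥ m·|𝒮|·(B² + B + 1)`): `Σ_S a_Sφ_S + c ≡ 0` on `{1,…,M}` forces `a ≡ 0`, `c = 0`. -/
theorem prod_parityFun_indep (𝒮 : Finset (Finset ℕ)) (hS : ∀ S ∈ 𝒮, ∀ p ∈ S, p.Prime)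
    (hSne : ∀ S ∈ 𝒮, S.Nonempty) (h𝒮 : 𝒮.Nonempty) {m B : ℝ}
    (hm : ∀ S ∈ 𝒮, ∏ p ∈ S, (p : ℝ) ^ 2 ≤ m) (hB : ∀ S ∈ 𝒮, ∀ S' ∈ 𝒮, (2 : ℝ) ^ (S ∪ S').card ≤ B)
    {M : ℕ} (hM : m * 𝒮.card * (B ^ 2 + B + 1) ≤ Real.log M) {a : Finset ℕ → ℝ} {c : ℝ}
    (h : ∀ k : St M, ∑ S ∈ 𝒮, a S * ∏ p ∈ S, parityFun p k + c = 0) :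
    (∀ S ∈ 𝒮, a S = 0) ∧ c = 0 := by
  classical
  -- sizes
  obtain ⟨S₀, hS₀⟩ := h𝒮
  have hcard : (1 : ℝ) ≤ 𝒮.card := by exact_mod_cast Finset.card_pos.2 ⟨S₀, hS₀⟩
  have hprod1 : ∀ S ∈ 𝒮, (1 : ℝ) ≤ ∏ p ∈ S, (p : ℝ) ^ 2 := by
    intro S hSS
    rw [← Finset.prod_const_one (s := S)]
    refine Finset.prod_le_prod (fun p _ => zero_le_one) fun p hp => ?_
    have h2 : (2 : ℝ) ≤ p := by exact_mod_cast (hS S hSS p hp).two_le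
    nlinarith
  have hm1 : 1 ≤ m := (hprod1 S₀ hS₀).trans (hm S₀ hS₀)
  have hB2 : 2 ≤ B := by
    have h := hB S₀ hS₀ S₀ hS₀
    rw [Finset.union_idempotent] at h
    have hc : 1 ≤ S₀.card := Finset.card_pos.2 (hSne S₀ hS₀)
    have : (2 : ℝ) ≤ 2 ^ S₀.card := by
      calc (2 : ℝ) = 2 ^ 1 := by norm_num
        _ ≤ 2 ^ S₀.card := pow_le_pow_right₀ (by norm_num) hc
    linarith
  have hT7 : 7 ≤ m * 𝒮.card * (B ^ 2 + B + 1) := by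
    have h1 : (1 : ℝ) * 1 ≤ m * 𝒮.card := mul_le_mul hm1 hcard (by norm_num) (by linarith)
    have h3 : (7 : ℝ) ≤ B ^ 2 + B + 1 := by nlinarith
    have h4 : 1 * 1 * (7 : ℝ) ≤ m * 𝒮.card * (B ^ 2 + B + 1) := mul_le_mul h1 h3 (by norm_num) (by nlinarith)
    linarith
  have hL7 : 7 ≤ Real.log M := hT7.trans hM
  have hM1 : 1 ≤ M := by
    by_contra h0
    have : M = 0 := by omega
    rw [this] at hL7; simp at hL7; linarith
  have hM0 : (0 : ℝ) < M := by exact_mod_cast hM1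
  -- notation
  set φ : Finset ℕ → St M → ℝ := fun S k => ∏ p ∈ S, parityFun p k with hφ
  set H : ℝ := ∑ k : St M, (1 : ℝ) / (k : ℕ) with hHdef
  set N : Finset ℕ → Finset ℕ → ℝ := fun S S' => ∑ k : St M, φ S k * φ S' k / (k : ℕ) with hN
  set Sm : Finset ℕ → ℝ := fun S => ∑ k : St M, φ S k / (k : ℕ) with hSm
  have h' : ∀ k : St M, ∑ S ∈ 𝒮, a S * φ S k + c = 0 := h
  clear_value φ H N Sm
  have hHI : ∑ i ∈ Icc 1 M, (1 : ℝ) / i = H := by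
    rw [hHdef, Finset.sum_coe_sort (Finset.Icc 1 M) (fun k => (1 : ℝ) / k)]
  have hTH : m * 𝒮.card * (B ^ 2 + B + 1) ≤ H := by
    have h1 := log_succ_le_harmonicSum M
    rw [hHI] at h1
    exact hM.trans ((Real.log_le_log hM0 (by linarith only [hM0])).trans h1)
  have hH0 : 0 < H := by linarith
  have hH1 : 1 ≤ H := by linarith
  have hφv : ∀ S (k : St M), φ S k = ∏ p ∈ S, parityFun p k := fun S k => by rw [hφ]
  have hNv : ∀ S S', N S S' = ∑ k : St M, φ S k * φ S' k / (k : ℕ) := fun S S' => by rw [hN]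
  have hSmv : ∀ S, Sm S = ∑ k : St M, φ S k / (k : ℕ) := fun S => by rw [hSm]
  -- Gram bounds
  have hNSS : ∀ S ∈ 𝒮, H / m ≤ N S S := by
    intro S hSS
    have h1 : H / ∏ p ∈ S, (p : ℝ) ^ 2 ≤ N S S := by
      rw [hNv, ← hHI]
      have e : ∑ k : St M, φ S k * φ S k / ((k : ℕ) : ℝ) =
          ∑ k ∈ Icc 1 M, (∏ p ∈ S, parityFun p k) * (∏ p ∈ S, parityFun p k) / (k : ℝ) := by
        rw [← Finset.sum_coe_sort (Finset.Icc 1 M)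
          (fun k : ℕ => (∏ p ∈ S, parityFun p k) * (∏ p ∈ S, parityFun p k) / (k : ℝ))]
        exact Finset.sum_congr rfl fun k _ => by rw [hφv]
      rw [e]
      exact sum_prod_parityFun_sq_div_ge S (hS S hSS) M
    exact (div_le_div_of_nonneg_left hH0.le (by linarith [hprod1 S hSS]) (hm S hSS)).trans h1
  have hNSS' : ∀ S ∈ 𝒮, ∀ S' ∈ 𝒮, S ≠ S' → |N S S'| ≤ B := by
    intro S hSS S' hSS' hne
    have e : N S S' = ∑ k ∈ Icc 1 M, (∏ p ∈ S, parityFun p k) * (∏ p ∈ S', parityFun p k) / (k : ℝ) := by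
      rw [hNv, ← Finset.sum_coe_sort (Finset.Icc 1 M)
        (fun k : ℕ => (∏ p ∈ S, parityFun p k) * (∏ p ∈ S', parityFun p k) / (k : ℝ))]
      exact Finset.sum_congr rfl fun k _ => by rw [hφv, hφv]
    rw [e]
    exact (abs_sum_prod_parityFun_mul_div_le S S' (hS S hSS) (hS S' hSS') hne M).trans (hB S hSS S' hSS')
  have hSmB : ∀ S ∈ 𝒮, Sm S ^ 2 ≤ B ^ 2 := by
    intro S hSS
    have e : Sm S = ∑ k ∈ Icc 1 M, (∏ p ∈ S, parityFun p k) / (k : ℝ) := by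
      rw [hSmv, ← Finset.sum_coe_sort (Finset.Icc 1 M) (fun k : ℕ => (∏ p ∈ S, parityFun p k) / (k : ℝ))]
      exact Finset.sum_congr rfl fun k _ => by rw [hφv]
    have h1 : |Sm S| ≤ B := by
      rw [e]
      refine (abs_sum_prod_parityFun_div_le S (hS S hSS) (hSne S hSS) M).trans ?_
      have h2 := hB S hSS S hSS
      rwa [Finset.union_idempotent] at h2
    calc Sm S ^ 2 = |Sm S| ^ 2 := (sq_abs _).symm
      _ ≤ B ^ 2 := pow_le_pow_left₀ (abs_nonneg _) h1 2
  -- the norm of g = Σ a_S φ_S + c vanishes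
  have hnorm0 : ∑ k : St M, (∑ S ∈ 𝒮, a S * φ S k + c) ^ 2 / ((k : ℕ) : ℝ) = 0 :=
    Finset.sum_eq_zero fun k _ => by rw [h' k]; simp
  have hnorm : ∑ k : St M, (∑ S ∈ 𝒮, a S * φ S k + c) ^ 2 / ((k : ℕ) : ℝ) =
      ∑ S ∈ 𝒮, ∑ S' ∈ 𝒮, a S * a S' * N S S' + 2 * c * ∑ S ∈ 𝒮, a S * Sm S + c ^ 2 * H := by
    rw [sum_norm_expand]
    simp only [hNv, hSmv, hHdef]
  -- lower bounds: complete the square in c, Cauchy–Schwarz, and the Gram diagonal dominance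
  set A2 : ℝ := ∑ S ∈ 𝒮, a S ^ 2 with hA2
  have hA2nn : 0 ≤ A2 := Finset.sum_nonneg fun S _ => sq_nonneg (a S)
  set U : ℝ := ∑ S ∈ 𝒮, a S * Sm S with hU
  have hU2 : U ^ 2 ≤ 𝒮.card * B ^ 2 * A2 := by
    have hCS : U ^ 2 ≤ A2 * ∑ S ∈ 𝒮, Sm S ^ 2 := by
      rw [hU, hA2]; exact Finset.sum_mul_sq_le_sq_mul_sq 𝒮 a Sm
    have hS2 : ∑ S ∈ 𝒮, Sm S ^ 2 ≤ 𝒮.card * B ^ 2 := by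
      have := Finset.sum_le_sum fun S hSS => hSmB S hSS
      rwa [Finset.sum_const, nsmul_eq_mul] at this
    have := mul_le_mul_of_nonneg_left hS2 hA2nn
    linarith
  have hc : -(U ^ 2) / H ≤ 2 * c * U + c ^ 2 * H := by
    rw [div_le_iff₀ hH0]
    have e : (2 * c * U + c ^ 2 * H) * H = (c * H + U) ^ 2 - U ^ 2 := by ring
    rw [e]
    linarith only [sq_nonneg (c * H + U)]
  have hGram : A2 * (H / m - 𝒮.card * B) ≤ ∑ S ∈ 𝒮, ∑ S' ∈ 𝒮, a S * a S' * N S S' := by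
    refine le_trans ?_ (form_ge_diag_sub_offdiag 𝒮 N a)
    rw [hA2, Finset.sum_mul]
    refine Finset.sum_le_sum fun S hSS => mul_le_mul_of_nonneg_left ?_ (sq_nonneg _)
    have hoff : ∑ S' ∈ 𝒮, (if S = S' then (0 : ℝ) else (|N S S'| + |N S' S|) / 2) ≤ ∑ S' ∈ 𝒮, B := by
      refine Finset.sum_le_sum fun S' hSS' => ?_
      by_cases he : S = S'
      · rw [if_pos he]; linarith
      · rw [if_neg he]
        have ha := hNSS' S hSS S' hSS' he
        have hb := hNSS' S' hSS' S hSS (Ne.symm he)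
        linarith
    rw [Finset.sum_const, nsmul_eq_mul] at hoff
    linarith [hNSS S hSS]
  -- conclude Σ a_S² = 0
  have hcoef : (𝒮.card : ℝ) ≤ H / m - 𝒮.card * B - 𝒮.card * B ^ 2 / H := by
    have hm0 : (0 : ℝ) < m := by linarith
    have h1 : (𝒮.card : ℝ) * (B ^ 2 + B + 1) ≤ H / m := by
      rw [le_div_iff₀ hm0]; linarith
    have h2 : (𝒮.card : ℝ) * B ^ 2 / H ≤ 𝒮.card * B ^ 2 := by
      rw [div_le_iff₀ hH0]
      have : 0 ≤ (𝒮.card : ℝ) * B ^ 2 := mul_nonneg (Nat.cast_nonneg _) (sq_nonneg B)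
      nlinarith
    nlinarith
  have hsq : A2 * 𝒮.card ≤ 0 := by
    have h1 : A2 * (H / m - 𝒮.card * B) - 𝒮.card * B ^ 2 * A2 / H ≤ 0 := by
      have h2 : ∑ S ∈ 𝒮, ∑ S' ∈ 𝒮, a S * a S' * N S S' - 𝒮.card * B ^ 2 * A2 / H ≤ 0 := by
        have h3 : U ^ 2 / H ≤ 𝒮.card * B ^ 2 * A2 / H := div_le_div_of_nonneg_right hU2 hH0.le
        rw [neg_div] at hc
        have h4 := hnorm0
        rw [hnorm] at h4
        linarith
      linarith
    have e : A2 * (H / m - 𝒮.card * B) - 𝒮.card * B ^ 2 * A2 / H =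
        A2 * (H / m - 𝒮.card * B - 𝒮.card * B ^ 2 / H) := by ring
    rw [e] at h1
    nlinarith
  have hA20 : A2 = 0 := by nlinarith
  have ha0 : ∀ S ∈ 𝒮, a S = 0 := by
    intro S hSS
    have := (Finset.sum_eq_zero_iff_of_nonneg (fun S (_ : S ∈ 𝒮) => sq_nonneg (a S))).1 (by rw [← hA2]; exact hA20) S hSS
    exact pow_eq_zero_iff (n := 2) (by norm_num) |>.1 this
  refine ⟨ha0, ?_⟩
  have h1 := h' ⟨1, Finset.mem_Icc.2 ⟨le_rfl, hM1⟩⟩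
  rw [Finset.sum_eq_zero (fun S hSS => by rw [ha0 S hSS, zero_mul]), zero_add] at h1
  exact h1

end Summit.RiemannHypothesis.RiemannHypothesis.Theorems.IntegerScrew

end
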